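import Literature.MathematicalPhysics.QuantumFieldTheory.Balaban1983to89.B11Eq117GaugeNormInvariance
import Literature.MathematicalPhysics.QuantumFieldTheory.Balaban1983to89.B9Eq3126H1BoundCLM

/-!
# `Balaban1983to89.B9Eq3126H1BoundGaugeOrbit` — T. Bałaban, *Propagators for lattice gauge theories in a background field*, Commun. Math. Phys. **99**
# (1985) 389–434 [Balaban1985BackgroundPropagators] (3.126) p. 420, (3.153) p. 426 with (3.34) p. 396, read in *The variational problem …*, Commun. Math.
# Phys. **102** (1985) 277–309 [Balaban1985Variational] (117) p. 295: THE pub-balaban NE9 CHAIN'S CHART LETTERS `H₁(V)`, `𝔊(V)` IN THE (115)-CURRENCY ARE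
# BOUNDED, WITH THE SMALL-FIELD CONSTANTS, AT EVERY BACKGROUND `V = U^u` GAUGE-EQUIVALENT TO A SMALL FIELD — (K) `B9Eq3126H1BoundCLM` carried along the
# gauge orbit by the norm invariance `B11Eq117GaugeNormInvariance`

statement-level skeleton of published theorems with citation tags; proofs where landed; nothing here is a claim about the Yang–Mills mass gap

PDF held: `paper:balaban1985-cmp99-background-propagators` pp. 395–396 (text layer, read 2026-08-22); (3.126)/(3.153)/(117) via the tree's docstrings.

THE PRINT.  [B9] p. 396 (3.34) *«G(U^u) = R(u)G(U)R(u⁻¹)»*; p. 398 (after (3.47)): *«All these inequalities are invariant with respect to gauge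
transformations of U»*; (3.35): the regularity class *«there exists a gauge transformation u on □ such that U^u = e^{iηA}, |A| < …»*.

WHY THIS FILE (cell context).  (K) `B9Eq3126H1BoundCLM.exists_H1_frakG_CLM_bound_of_small_field` (owner t4-ne9-p1 g81) bounds the operator norms
`‖H1LatticeCLM … (∇_U)‖ ≤ C_H′`, `‖frakGLatticeCLM … (∇_U)‖ ≤ C_G′` — the letters that fix the chart radii of `Support/NE9CurChartUniformBall` — uniformly
over the SMALL FIELDS `‖U(b) − 1‖ ≤ ε ≤ ε₅` of a fixed lattice.  By `B11Eq117GaugeNormInvariance` these norms are gauge-INVARIANT functions of the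
background, so the same constants bound the letters at every `V = U^u`: print's sentence after (3.47) for the chain's (3.126)/(3.153) letters, and
the (K)-input of the chart on the orbit of the small-field ball ((3.35)'s class on the one-cube torus).

WHAT IS PROVED (sorry-free; 0 `def`; composition BY NAME — no inequality of the papers beyond (K)'s).
* **`exists_H1_frakG_CLM_bound_of_gaugeOrbit_small_field`** — (K)'s `∃ C_H′ C_G′ ε₅ > 0` (per lattice, fixed level maps) such that for EVERY `U` with E162's
  data, `‖U(b) − 1‖ ≤ ε ≤ ε₅`, `hRS`, EVERY gauge function `g` (`g(x) ∈ U1` unitary, `τ`-central, fibrewise isometric) and ANY positivity / onto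
  witnesses at `U` and at `U^g` (regularity witnesses of `U^g` arbitrary): `‖H1LatticeCLM … (∇_{U^g})‖ ≤ C_H′ ∧ ‖frakGLatticeCLM … (∇_{U^g})‖ ≤ C_G′`.
MODEL / DECLARED READINGS.  (M1) as (K) and `B11Eq117GaugeNormInvariance`; the coarse gauge `u₁ = g ∘ centre` on the block fields; (M2) DISPLAYED:
(K)'s data letters, `hRS` at `U`, `g(x) ∈ U1`, `hstar`, `hτ`, `hAd`, witnesses `hpos/hQ` at `U` AND `hpos′/hQ′` at `U^g` ((K) quantifies them too;
`hpos′` is derivable — `B9Eq334LaplaceACovariance.hpos_gaugeU`); (M3) NOT HERE: the chart (S′) on the orbit (letters `C(U)`, `W`, regimes), lattice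
uniformity, any new bound.
HONEST SCOPE.  Composition BY NAME; constants are (K)'s, untouched; NOT summit progress (cell pub-balaban: NE9 NOT PRINTED / NOT PROVED; «NE9 ⇐ the
named binders»; spine PROVED 0/9; HONEST DEPENDENCY: continuum YM on T⁴ ⇐ BetaPertH ∧ nine spine estimates (0/9 proved); BetaPertH ⇐ (D1) ∧ (D4) ∧
CAP+tail; G-an2-4 gates asym, D1 and NE2/3/4).  Unit `b2b-balaban-t4-ne9-formalise-leaf-03` (NE9 crux-team leaf prover, gen 60), INTENT I-ne9leaf03-g60-1
file (G7); NEW file importing `B11Eq117GaugeNormInvariance` + `B9Eq3126H1BoundCLM`; modifies nothing.  Net new unproved facts: 0.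
-/

noncomputable section

open scoped InnerProductSpace ComplexConjugate BigOperators

namespace Literature.MathematicalPhysics.QuantumFieldTheory.Balaban1983to89.B9Eq3126H1BoundGaugeOrbit

open B9SectCLatticeCarrier (Bond bpos btgt)
open B4Sect5Torus (TSite)
open B9Eq311L2Pairing (WL2)
open B9Eq319QprimeTorus (fineP centre)
open B11Eq115Space (NegSize Space115 levWeight)
open B11Eq111FrakG (nabla115)
open B11Eq103H1Complex (BondL2K H1LatticeCLM frakGLatticeCLM)
open B9Eq310HessianOperator (adTransportW)
open B7Prop1Explicit (U1 Wcx boxVec)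
open B9Eq315QTorus (perCfg cornerSite QtorusW laplaceAofBackground laplaceAofBackground_eq)
open B9Eq3126H1BoundCLM (exists_H1_frakG_CLM_bound_of_small_field)
open B9Eq328GaugeAction B9Eq333ProjectionCovariance B9Eq334LaplaceACovariance B11Eq115GaugeIsometry B11Eq117GaugeNormInvariance

variable {d : ℕ} (L : ℕ) [NeZero L] (m : Fin d → ℕ) [∀ i, NeZero (fineP L m i)] (hL : 1 ≤ L)
  {𝔸 : Type*} [NormedRing 𝔸] [NormedAlgebra ℂ 𝔸] [CompleteSpace 𝔸] [NormOneClass 𝔸] [StarRing 𝔸] [NormedStarGroup 𝔸] [StarModule ℂ 𝔸]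
  [FiniteDimensional ℂ 𝔸]
  {W : Type*} [NormedAddCommGroup W] [InnerProductSpace ℂ W] [FiniteDimensional ℂ W] (φ : W ≃ₗ[ℂ] 𝔸) {c₀ c₁ : ℝ} [Fact (0 < c₀)] [Fact (0 < c₁)]

/-- **THE CHART LETTERS `H₁(U^u)`, `𝔊(U^u)` IN THE (115)-CURRENCY ARE BOUNDED BY (K)'s SMALL-FIELD CONSTANTS ON THE WHOLE GAUGE ORBIT OF THE
SMALL-FIELD BALL** (fixed lattice, fixed level maps; regularity/positivity/onto witnesses at `U^u` arbitrary).
[cite: Balaban1985BackgroundPropagators, (3.126) p.420, (3.153) p.426, (3.34) p.396, p.398; Balaban1985Variational, (117) p.295] -/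
theorem exists_H1_frakG_CLM_bound_of_gaugeOrbit_small_field {η : ℝ} [Fact (0 < (L : ℝ))] [Fact (0 < η)] (lev₀ : Bond d (fineP L m) → ℕ)
    (levB : Bond d m → ℕ) (lev₁ : Bond d (fineP L m) × Fin d → ℕ) {a : ℝ} (ha : 0 < a) {Mφ Mφ' : ℝ} (hMφ : 0 ≤ Mφ) (hMφ' : 0 ≤ Mφ')
    (hφ : ∀ w, ‖φ w‖ ≤ Mφ * ‖w‖) (hφ' : ∀ X, ‖φ.symm X‖ ≤ Mφ' * ‖X‖) (τ : 𝔸 →ₗ[ℂ] ℂ) {Cτ : ℝ} (hτC : ∀ X, ‖τ X‖ ≤ Cτ * ‖X‖) (hCτ : 0 ≤ Cτ) :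
    ∃ CH' CG' ε₅ : ℝ, 0 < CH' ∧ 0 < CG' ∧ 0 < ε₅ ∧ ∀ (U : Bond d (fineP L m) → 𝔸ˣ) {α : ℝ} (hα1 : α ≤ 1 / 64)
      (hU1 : ∀ (x : B7Prop1Explicit.Site d) (κ : Fin d), perCfg (fineP L m) U x κ ∈ U1 𝔸)
      (hreg : ∀ (y : TSite d m) (κ : Fin d) (r : Fin d → Fin L), ‖((Wcx L (perCfg (fineP L m) U) (cornerSite L y) κ (boxVec L r) : 𝔸ˣ) : 𝔸) - 1‖ ≤ α)
      {ε : ℝ}, 0 ≤ ε → ε ≤ ε₅ → (∀ b, ‖(U b : 𝔸) - 1‖ ≤ ε) →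
      (∀ (b : Bond d (fineP L m)) (v u : W), ⟪adTransportW φ U b v, u⟫_ℂ = ⟪v, adTransportW φ (fun b => (U b)⁻¹) b u⟫_ℂ) →
      ∀ (hpos : ∀ x : BondL2K ℂ d (fineP L m) c₀ W, x ≠ 0 →
          0 < RCLike.re ⟪x, laplaceAofBackground L m hL φ U hα1 hU1 hreg τ η (c₀ := c₀) (c₁ := c₁) a x⟫_ℂ)
        (hQ : Function.Surjective (QtorusW L m hL φ U hα1 hU1 hreg (c₀ := c₀) (c₁ := c₁)))
        {g : TSite d (fineP L m) → 𝔸ˣ}, (∀ x, g x ∈ U1 𝔸) → (∀ x, star (g x : 𝔸) = ((g x)⁻¹ : 𝔸ˣ)) →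
        (∀ (x : TSite d (fineP L m)) (X : 𝔸), τ (AdA (g x) X) = τ X) →
        (∀ (x : TSite d (fineP L m)) (v v' : W), ⟪AdW φ (g x) v, AdW φ (g x) v'⟫_ℂ = ⟪v, v'⟫_ℂ) →
        ∀ (hU1' : ∀ (x : B7Prop1Explicit.Site d) (κ : Fin d), perCfg (fineP L m) (gaugeU g U) x κ ∈ U1 𝔸)
          (hreg' : ∀ (y : TSite d m) (κ : Fin d) (r : Fin d → Fin L),
            ‖((Wcx L (perCfg (fineP L m) (gaugeU g U)) (cornerSite L y) κ (boxVec L r) : 𝔸ˣ) : 𝔸) - 1‖ ≤ α)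
          (hpos' : ∀ x : BondL2K ℂ d (fineP L m) c₀ W, x ≠ 0 →
            0 < RCLike.re ⟪x, laplaceAofBackground L m hL φ (gaugeU g U) hα1 hU1' hreg' τ η (c₀ := c₀) (c₁ := c₁) a x⟫_ℂ)
          (hQ' : Function.Surjective (QtorusW L m hL φ (gaugeU g U) hα1 hU1' hreg' (c₀ := c₀) (c₁ := c₁))),
        ‖H1LatticeCLM (L := (L : ℝ)) (η := η) (lev₀ := lev₀) (levB := levB) φ hpos' hQ' lev₁ (nabla115 η (gaugeU g U))‖ ≤ CH' ∧
        ‖frakGLatticeCLM (L := (L : ℝ)) (η := η) (lev₀ := lev₀) φ hpos' hQ' lev₁ (nabla115 η (gaugeU g U))‖ ≤ CG' := by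
  obtain ⟨CH', CG', ε₅, hCH', hCG', hε₅, H⟩ :=
    exists_H1_frakG_CLM_bound_of_small_field L m hL φ (c₀ := c₀) (c₁ := c₁) (η := η) lev₀ levB lev₁ ha hMφ hMφ' hφ hφ' τ hτC hCτ
  refine ⟨CH', CG', ε₅, hCH', hCG', hε₅, ?_⟩
  intro U α hα1 hU1 hreg ε hε hεε₅ hUε hRS hpos hQ g hg hstar hτ hAd hU1' hreg' hpos' hQ'
  obtain ⟨hH, hG⟩ := H U hα1 hU1 hreg hε hεε₅ hUε hRS hpos hQ
  have hQQ : ∀ f : BondL2K ℂ d (fineP L m) c₀ W,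
      QtorusW L m hL φ (gaugeU g U) hα1 hU1' hreg' (c₁ := c₁) (gaugeW φ (fun b : Bond d (fineP L m) => g (bpos b)) f) =
      gaugeW φ (fun c : Bond d m => g (centre L m (bpos c))) (QtorusW L m hL φ U hα1 hU1 hreg (c₁ := c₁) f) :=
    fun f => QtorusW_gaugeU L m g U hL φ hα1 hU1 hreg hU1' hreg' f
  refine ⟨?_, ?_⟩
  · rw [laplaceAofBackground_eq] at hpos hpos'
    rw [opNorm_H1LatticeCLM_gaugeU L m φ lev₁ τ U (fun c : Bond d m => g (centre L m (bpos c))) hτ hstar hAd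
      (fun c => hAd (centre L m (bpos c))) hQQ hpos hpos' hQ hQ' hg (fun c => hg _)]
    exact hH
  · rw [laplaceAofBackground_eq] at hpos hpos'
    rw [opNorm_frakGLatticeCLM_gaugeU L m φ lev₁ τ U (fun c : Bond d m => g (centre L m (bpos c))) hτ hstar hAd
      (fun c => hAd (centre L m (bpos c))) hQQ hpos hpos' hQ hQ' hg]
    exact hG

end Literature.MathematicalPhysics.QuantumFieldTheory.Balaban1983to89.B9Eq3126H1BoundGaugeOrbit

end
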